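import Summits.NavierStokesRegularity.NavierStokesRegularity.Theorems.FrequencyRigidity.Negative.RSSWall
import HarnessLib

/-!
# Crux `FrequencyRigidity` (stmt-NavierStokesRegularity-2955), wall engine, stub S5
# `stub_coRotatingKernel` — file 2/3: the screw group, averages, invariance of limits

Helper file (lands `--supports stmt-NavierStokesRegularity-2955`; theorems only) for the registered
stub `stub_coRotatingKernel`.  Notation (informal; no definitions are introduced): for `c > 0`,
`(g_c K)(t,x) = c³ K(c²t, R_c(cx))`, `R_c = rotZ (−2α log c)` (as in file 1/3,
`…CoRotatingKernelPush`, which this file does not import: the two are independent).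

* the GROUP LAW `g_c g_{c'} = g_{cc'}`, `g_1 = 1` (`screw_screw`, `screw_one`), whence invariance
  under `g_c` passes to `g_{c⁻¹}` and to all `g_{c^k}` (`screw_inv_invariant`, `screw_pow_invariant`);
* FINITE AVERAGES of adapted kernels of one drift are adapted (`isAdaptedBackwardKernel_average`:
  all five clauses are linear/convex) and stay between the same Gaussians (`average_bounds`);
* the discrete Cesàro averages `A_N = (N+1)⁻¹ Σ_{k≤N} g_{c^k} K` are ALMOST `g_c`-invariant:
  `g_c A_N − A_N = (N+1)⁻¹ (g_{c^{N+1}} K − K)` (`screw_average_sub`, telescoping), which is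
  `O((−t)^{−3/2}/N)` under the Gaussian upper bound, so every pointwise subsequential limit of
  `(A_N)` is EXACTLY `g_c`-invariant (`screw_invariant_of_tendsto_average`).

File 3/3 (`…CoRotatingKernel`) runs the two extractions (the kernel-compactness stub S4) and the
density argument.
-/

noncomputable section

-- the problem namespace `Summit.NavierStokesRegularity.NavierStokesRegularity.…` repeats the summit name
set_option linter.dupNamespace false

namespace Summit.NavierStokesRegularity.NavierStokesRegularity.Theorems.FrequencyRigidity.MovingAdjointBernoulli

open Literature.Analysis.FluidPDE
open Summit.NavierStokesRegularity.NavierStokesRegularity.Theorems.FrequencyRigidity.Negative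
open MeasureTheory Set Filter Topology Function
open scoped Laplacian InnerProductSpace RealInnerProductSpace ContDiff

/-! ### The screw group `g_c g_{c'} = g_{cc'}`, `g_1 = 1` -/

/-- **Group law** `g_c (g_{c'} K) = g_{cc'} K` (pointwise; `R_{c'} R_c = R_{cc'}` by
`log(cc') = log c + log c'`). -/
theorem screw_screw (α : ℝ) (K : ℝ → E3 → ℝ) {c c' : ℝ} (hc : 0 < c) (hc' : 0 < c') (t : ℝ)
    (x : E3) :
    c ^ 3 * (c' ^ 3 * K (c' ^ 2 * (c ^ 2 * t))
        (rotZ (-(α * (2 * Real.log c'))) (c' • rotZ (-(α * (2 * Real.log c))) (c • x)))) =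
      (c * c') ^ 3 * K ((c * c') ^ 2 * t)
        (rotZ (-(α * (2 * Real.log (c * c')))) ((c * c') • x)) := by
  have hzs : ∀ (θ a : ℝ) (z : E3), rotZ θ (a • z) = a • rotZ θ z := fun θ a z => by
    rw [← rotZL_apply, map_smul, rotZL_apply]
  simp only [hzs, smul_smul, ← rotZ_add, Real.log_mul hc.ne' hc'.ne']
  have e1 : c' ^ 2 * (c ^ 2 * t) = (c * c') ^ 2 * t := by ring
  have e2 : -(α * (2 * Real.log c')) + -(α * (2 * Real.log c)) =
      -(α * (2 * (Real.log c + Real.log c'))) := by ring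
  rw [e1, e2, mul_comm c' c]
  ring

/-- **Unit** `g_1 K = K`. -/
theorem screw_one (α : ℝ) (K : ℝ → E3 → ℝ) (t : ℝ) (x : E3) :
    (1:ℝ) ^ 3 * K ((1:ℝ) ^ 2 * t) (rotZ (-(α * (2 * Real.log 1))) ((1:ℝ) • x)) = K t x := by
  simp

/-- Invariance under `g_c` implies invariance under `g_{c⁻¹}` (`g_{c⁻¹} = g_c⁻¹`). -/
theorem screw_inv_invariant {α c : ℝ} (hc : 0 < c) {G : ℝ → E3 → ℝ}
    (hG : ∀ t < 0, ∀ x, c ^ 3 * G (c ^ 2 * t) (rotZ (-(α * (2 * Real.log c))) (c • x)) = G t x) :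
    ∀ t < 0, ∀ x,
      c⁻¹ ^ 3 * G (c⁻¹ ^ 2 * t) (rotZ (-(α * (2 * Real.log c⁻¹))) (c⁻¹ • x)) = G t x := by
  intro t ht x
  have ht' : c⁻¹ ^ 2 * t < 0 := mul_neg_of_pos_of_neg (by positivity) ht
  rw [← hG _ ht' (rotZ (-(α * (2 * Real.log c⁻¹))) (c⁻¹ • x)),
    screw_screw α G (inv_pos.2 hc) hc t x, inv_mul_cancel₀ hc.ne']
  exact screw_one α G t x

/-- Invariance under `g_c` implies invariance under every `g_{c^k}`. -/
theorem screw_pow_invariant {α c : ℝ} (hc : 0 < c) {G : ℝ → E3 → ℝ}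
    (hG : ∀ t < 0, ∀ x, c ^ 3 * G (c ^ 2 * t) (rotZ (-(α * (2 * Real.log c))) (c • x)) = G t x)
    (k : ℕ) :
    ∀ t < 0, ∀ x, (c ^ k) ^ 3 * G ((c ^ k) ^ 2 * t)
      (rotZ (-(α * (2 * Real.log (c ^ k)))) ((c ^ k) • x)) = G t x := by
  induction k with
  | zero => intro t ht x; simp
  | succ k ih =>
    intro t ht x
    rw [pow_succ c k, ← screw_screw α G (pow_pos hc k) hc t x,
      hG _ (mul_neg_of_pos_of_neg (by positivity) ht) _]
    exact ih t ht x

/-! ### Finite averages of adapted kernels -/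

/-- **Finite averages of adapted kernels are adapted.**  If `F 0, …, F N` are adapted backward
kernels of the same operator `∂ₜ + v·∇ − νΔ` on `(−∞,0)` with the same pole `(0,0)`, so is their
mean `(N+1)⁻¹ Σ_{k≤N} F k`: all five clauses are linear (resp. convex). -/
theorem isAdaptedBackwardKernel_average {ν : ℝ} {v : ℝ → E3 → E3} {F : ℕ → ℝ → E3 → ℝ} (N : ℕ)
    (hF : ∀ k, IsAdaptedBackwardKernel ν v (Iio 0) 0 0 (F k)) :
    IsAdaptedBackwardKernel ν v (Iio 0) 0 0
      (fun t x => ((N:ℝ) + 1)⁻¹ * ∑ k ∈ Finset.range (N + 1), F k t x) where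
  contDiffOn := by
    have h : ContDiffOn ℝ 2 (fun p : ℝ × E3 => ∑ k ∈ Finset.range (N + 1), uncurry (F k) p)
        (Iio (0:ℝ) ×ˢ (univ : Set E3)) :=
      ContDiffOn.sum fun k _ => (hF k).contDiffOn
    exact contDiffOn_const.mul h
  pos t ht x :=
    mul_pos (inv_pos.2 (Nat.cast_add_one_pos N))
      (Finset.sum_pos (fun k _ => (hF k).pos t ht x) Finset.nonempty_range_add_one)
  adjoint_eq t ht x := by
    have hT : timeDerivWithin (Iio 0)
        (fun t x => ((N:ℝ) + 1)⁻¹ * ∑ k ∈ Finset.range (N + 1), F k t x) t x =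
        ((N:ℝ) + 1)⁻¹ * ∑ k ∈ Finset.range (N + 1), timeDerivWithin (Iio 0) (F k) t x := by
      simp only [timeDerivWithin_apply]
      have h : ∀ k ∈ Finset.range (N + 1), HasDerivWithinAt (fun s => F k s x)
          (derivWithin (fun s => F k s x) (Iio 0) t) (Iio 0) t :=
        fun k _ => ((hF k).differentiableWithinAt_time ht x).hasDerivWithinAt
      exact ((HasDerivWithinAt.fun_sum h).const_mul _).derivWithin (uniqueDiffOn_Iio 0 t ht)
    have hX : fderiv ℝ (fun z : E3 => ((N:ℝ) + 1)⁻¹ * ∑ k ∈ Finset.range (N + 1), F k t z) x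
        (v t x) = ((N:ℝ) + 1)⁻¹ * ∑ k ∈ Finset.range (N + 1), fderiv ℝ (F k t) x (v t x) := by
      have h : ∀ k ∈ Finset.range (N + 1), HasFDerivAt (fun z => F k t z) (fderiv ℝ (F k t) x) x :=
        fun k _ => (((hF k).contDiff_slice ht).differentiable two_ne_zero x).hasFDerivAt
      rw [((HasFDerivAt.fun_sum h).const_mul (((N:ℝ) + 1)⁻¹)).fderiv]
      simp only [FunLike.coe_smul, Pi.smul_apply, FunLike.coe_sum, Finset.sum_apply,
        smul_eq_mul]
    have hL : (Δ (fun z : E3 => ((N:ℝ) + 1)⁻¹ * ∑ k ∈ Finset.range (N + 1), F k t z)) x =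
        ((N:ℝ) + 1)⁻¹ * ∑ k ∈ Finset.range (N + 1), (Δ (F k t)) x := by
      have hk : ∀ k ∈ Finset.range (N + 1), ContDiff ℝ 2 (F k t) :=
        fun k _ => (hF k).contDiff_slice ht
      have hs : ContDiff ℝ 2 (fun z : E3 => ∑ k ∈ Finset.range (N + 1), F k t z) :=
        ContDiff.sum hk
      have e1 : (fun z : E3 => ((N:ℝ) + 1)⁻¹ * ∑ k ∈ Finset.range (N + 1), F k t z) =
          ((N:ℝ) + 1)⁻¹ • (fun z : E3 => ∑ k ∈ Finset.range (N + 1), F k t z) := by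
        funext z
        simp only [Pi.smul_apply, smul_eq_mul]
      rw [e1, InnerProductSpace.laplacian_smul _ hs.contDiffAt, smul_eq_mul]
      congr 1
      simp only [InnerProductSpace.laplacian_eq_iteratedFDeriv_stdOrthonormalBasis,
        iteratedFDeriv_sum hk, Finset.sum_apply, _root_.sum_apply]
      exact Finset.sum_comm
    have hadj : ∀ k ∈ Finset.range (N + 1),
        timeDerivWithin (Iio 0) (F k) t x + fderiv ℝ (F k t) x (v t x) + ν * (Δ (F k t)) x = 0 :=
      fun k _ => (hF k).adjoint_eq t ht x
    show timeDerivWithin (Iio 0)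
        (fun t x => ((N:ℝ) + 1)⁻¹ * ∑ k ∈ Finset.range (N + 1), F k t x) t x +
        fderiv ℝ (fun z : E3 => ((N:ℝ) + 1)⁻¹ * ∑ k ∈ Finset.range (N + 1), F k t z) x (v t x) +
        ν * (Δ (fun z : E3 => ((N:ℝ) + 1)⁻¹ * ∑ k ∈ Finset.range (N + 1), F k t z)) x = 0
    have hsum : ∑ k ∈ Finset.range (N + 1),
        (timeDerivWithin (Iio 0) (F k) t x + fderiv ℝ (F k t) x (v t x) + ν * (Δ (F k t)) x) = 0 :=
      Finset.sum_eq_zero hadj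
    rw [Finset.sum_add_distrib, Finset.sum_add_distrib, ← Finset.mul_sum] at hsum
    rw [hT, hX, hL]
    linear_combination ((N:ℝ) + 1)⁻¹ * hsum
  integral_eq_one t ht := by
    show ∫ x, ((N:ℝ) + 1)⁻¹ * ∑ k ∈ Finset.range (N + 1), F k t x = 1
    rw [integral_const_mul, integral_finsetSum _ (fun k _ => (hF k).integrable ht),
      Finset.sum_congr rfl (fun k _ => (hF k).integral_eq_one t ht), Finset.sum_const,
      Finset.card_range, nsmul_eq_mul, mul_one, Nat.cast_add_one]
    exact inv_mul_cancel₀ (Nat.cast_add_one_pos (α := ℝ) N).ne'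
  tendsto_integral_mul φ hφ hM := by
    obtain ⟨M, hM⟩ := hM
    have hint : ∀ t ∈ Iio (0:ℝ), ∀ k ∈ Finset.range (N + 1),
        Integrable (fun x => φ x * F k t x) := by
      intro t ht k _
      refine ((hF k).integrable ht).bdd_mul (c := M) hφ.aestronglyMeasurable
        (Eventually.of_forall fun x => ?_)
      rw [Real.norm_eq_abs]
      exact hM x
    have key : ∀ t ∈ Iio (0:ℝ),
        ∫ x, φ x * (((N:ℝ) + 1)⁻¹ * ∑ k ∈ Finset.range (N + 1), F k t x) =
          ((N:ℝ) + 1)⁻¹ * ∑ k ∈ Finset.range (N + 1), ∫ x, φ x * F k t x := by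
      intro t ht
      rw [← integral_finsetSum _ (hint t ht), ← integral_const_mul]
      refine integral_congr_ae (Eventually.of_forall fun x => ?_)
      simp only [Finset.mul_sum]
      exact Finset.sum_congr rfl fun k _ => by ring
    have hlim : Tendsto (fun t => ((N:ℝ) + 1)⁻¹ * ∑ k ∈ Finset.range (N + 1), ∫ x, φ x * F k t x)
        (𝓝[<] 0) (𝓝 (((N:ℝ) + 1)⁻¹ * ∑ k ∈ Finset.range (N + 1), φ 0)) :=
      (tendsto_finsetSum _ fun k _ => (hF k).tendsto_integral_mul φ hφ ⟨M, hM⟩).const_mul _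
    rw [Finset.sum_const, Finset.card_range, nsmul_eq_mul, Nat.cast_add_one, ← mul_assoc,
      inv_mul_cancel₀ (Nat.cast_add_one_pos (α := ℝ) N).ne', one_mul] at hlim
    show Tendsto (fun t => ∫ x, φ x * (((N:ℝ) + 1)⁻¹ * ∑ k ∈ Finset.range (N + 1), F k t x))
      (𝓝[<] 0) (𝓝 (φ 0))
    refine hlim.congr' ?_
    filter_upwards [self_mem_nhdsWithin] with t ht
    exact (key t ht).symm

/-- Averages stay between the same two Gaussians (convexity of the order interval). -/
theorem average_bounds {F : ℕ → ℝ → E3 → ℝ} {L U : ℝ → E3 → ℝ} (N : ℕ)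
    (hb : ∀ k, ∀ t ∈ Iio (0:ℝ), ∀ x, L t x ≤ F k t x ∧ F k t x ≤ U t x) :
    ∀ t ∈ Iio (0:ℝ), ∀ x, L t x ≤ ((N:ℝ) + 1)⁻¹ * ∑ k ∈ Finset.range (N + 1), F k t x ∧
      ((N:ℝ) + 1)⁻¹ * ∑ k ∈ Finset.range (N + 1), F k t x ≤ U t x := by
  intro t ht x
  have hN : (0:ℝ) < (N:ℝ) + 1 := Nat.cast_add_one_pos N
  have h1 : ∑ k ∈ Finset.range (N + 1), F k t x ≤ ∑ k ∈ Finset.range (N + 1), U t x :=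
    Finset.sum_le_sum fun k _ => (hb k t ht x).2
  have h2 : ∑ k ∈ Finset.range (N + 1), L t x ≤ ∑ k ∈ Finset.range (N + 1), F k t x :=
    Finset.sum_le_sum fun k _ => (hb k t ht x).1
  rw [Finset.sum_const, Finset.card_range, nsmul_eq_mul, Nat.cast_add_one] at h1 h2
  constructor
  · rw [← inv_mul_cancel_left₀ hN.ne' (L t x)]
    exact mul_le_mul_of_nonneg_left h2 (inv_pos.2 hN).le
  · rw [← inv_mul_cancel_left₀ hN.ne' (U t x)]
    exact mul_le_mul_of_nonneg_left h1 (inv_pos.2 hN).le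

/-! ### Cesàro averages over the screw group are almost invariant; limits are invariant -/

/-- **Telescoping**: `g_c A_N − A_N = (N+1)⁻¹ (g_{c^{N+1}} K − K)` for the Cesàro averages
`A_N = (N+1)⁻¹ Σ_{k≤N} g_{c^k} K` (group law `g_c g_{c^k} = g_{c^{k+1}}`). -/
theorem screw_average_sub (α : ℝ) (K : ℝ → E3 → ℝ) {c : ℝ} (hc : 0 < c) (N : ℕ) (t : ℝ) (x : E3) :
    c ^ 3 * (((N:ℝ) + 1)⁻¹ * ∑ k ∈ Finset.range (N + 1),
        (c ^ k) ^ 3 * K ((c ^ k) ^ 2 * (c ^ 2 * t))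
          (rotZ (-(α * (2 * Real.log (c ^ k)))) ((c ^ k) • rotZ (-(α * (2 * Real.log c))) (c • x)))) -
      ((N:ℝ) + 1)⁻¹ * ∑ k ∈ Finset.range (N + 1),
        (c ^ k) ^ 3 * K ((c ^ k) ^ 2 * t) (rotZ (-(α * (2 * Real.log (c ^ k)))) ((c ^ k) • x)) =
    ((N:ℝ) + 1)⁻¹ * ((c ^ (N + 1)) ^ 3 * K ((c ^ (N + 1)) ^ 2 * t)
        (rotZ (-(α * (2 * Real.log (c ^ (N + 1))))) ((c ^ (N + 1)) • x)) - K t x) := by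
  set f : ℕ → ℝ := fun k => (c ^ k) ^ 3 * K ((c ^ k) ^ 2 * t)
    (rotZ (-(α * (2 * Real.log (c ^ k)))) ((c ^ k) • x)) with hf
  have hstep : ∀ k : ℕ, c ^ 3 * ((c ^ k) ^ 3 * K ((c ^ k) ^ 2 * (c ^ 2 * t))
      (rotZ (-(α * (2 * Real.log (c ^ k)))) ((c ^ k) • rotZ (-(α * (2 * Real.log c))) (c • x)))) =
      f (k + 1) := fun k => by
    rw [screw_screw α K hc (pow_pos hc k) t x]
    simp only [hf, pow_succ' c k]
  have h0 : f 0 = K t x := by simp [hf]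
  have hN : f (N + 1) = (c ^ (N + 1)) ^ 3 * K ((c ^ (N + 1)) ^ 2 * t)
      (rotZ (-(α * (2 * Real.log (c ^ (N + 1))))) ((c ^ (N + 1)) • x)) := rfl
  have hS : c ^ 3 * (((N:ℝ) + 1)⁻¹ * ∑ k ∈ Finset.range (N + 1),
      (c ^ k) ^ 3 * K ((c ^ k) ^ 2 * (c ^ 2 * t))
        (rotZ (-(α * (2 * Real.log (c ^ k)))) ((c ^ k) • rotZ (-(α * (2 * Real.log c))) (c • x)))) =
      ((N:ℝ) + 1)⁻¹ * ∑ k ∈ Finset.range (N + 1), f (k + 1) := by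
    rw [mul_left_comm, Finset.mul_sum]
    congr 1
    exact Finset.sum_congr rfl fun k _ => hstep k
  rw [hS, ← mul_sub, ← hN, ← h0]
  congr 1
  have h1 := Finset.sum_range_succ' f (N + 1)
  have h2 := Finset.sum_range_succ f (N + 1)
  linarith

/-- **Pointwise limits of Cesàro averages are invariant.**  If the pushes `g_{c^k} K` are
uniformly bounded by `C(−t)^{−3/2}` (the Gaussian upper bound) and nonnegative, and along a
subsequence `φ` the averages `A_{φ n}` converge pointwise on `(−∞,0) × ℝ³` to `G`, then
`g_c G = G`: `g_c A_N → g_c G` pointwise (the push acts through point evaluation), while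
`g_c A_N − A_N = O((−t)^{−3/2}/N) → 0`. -/
theorem screw_invariant_of_tendsto_average {α c C : ℝ} (hc : 0 < c) {K G : ℝ → E3 → ℝ}
    {φ : ℕ → ℕ} (hφ : StrictMono φ)
    (hKb : ∀ k : ℕ, ∀ t < 0, ∀ x, 0 ≤ (c ^ k) ^ 3 * K ((c ^ k) ^ 2 * t)
        (rotZ (-(α * (2 * Real.log (c ^ k)))) ((c ^ k) • x)) ∧
      (c ^ k) ^ 3 * K ((c ^ k) ^ 2 * t) (rotZ (-(α * (2 * Real.log (c ^ k)))) ((c ^ k) • x)) ≤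
        C * ((0:ℝ) - t) ^ (-(3:ℝ) / 2))
    (hlim : ∀ t < 0, ∀ x, Tendsto (fun n => ((φ n : ℝ) + 1)⁻¹ * ∑ k ∈ Finset.range (φ n + 1),
        (c ^ k) ^ 3 * K ((c ^ k) ^ 2 * t) (rotZ (-(α * (2 * Real.log (c ^ k)))) ((c ^ k) • x)))
      atTop (𝓝 (G t x))) :
    ∀ t < 0, ∀ x, c ^ 3 * G (c ^ 2 * t) (rotZ (-(α * (2 * Real.log c))) (c • x)) = G t x := by
  intro t ht x
  have hs : c ^ 2 * t < 0 := mul_neg_of_pos_of_neg (pow_pos hc 2) ht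
  -- the averages at the moved point, pushed: converge to `g_c G (t,x)`
  have hA := (hlim _ hs (rotZ (-(α * (2 * Real.log c))) (c • x))).const_mul (c ^ 3)
  -- the averages at `(t,x)`: converge to `G t x`
  have hB := hlim t ht x
  -- their difference
  set d : ℕ → ℝ := fun n => ((φ n : ℝ) + 1)⁻¹ * ((c ^ (φ n + 1)) ^ 3 * K ((c ^ (φ n + 1)) ^ 2 * t)
    (rotZ (-(α * (2 * Real.log (c ^ (φ n + 1))))) ((c ^ (φ n + 1)) • x)) - K t x) with hd
  have hK0 : 0 ≤ K t x ∧ K t x ≤ C * ((0:ℝ) - t) ^ (-(3:ℝ) / 2) := by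
    have h := hKb 0 t ht x
    simp only [pow_zero, one_pow, one_mul, Real.log_one, mul_zero, neg_zero, rotZ_zero,
      one_smul] at h
    exact h
  have hdb : ∀ n, ‖d n‖ ≤ ((φ n : ℝ) + 1)⁻¹ * (C * ((0:ℝ) - t) ^ (-(3:ℝ) / 2)) := fun n => by
    have hn : (0:ℝ) < (φ n : ℝ) + 1 := Nat.cast_add_one_pos _
    rw [hd, Real.norm_eq_abs, abs_mul, abs_of_pos (inv_pos.2 hn)]
    refine mul_le_mul_of_nonneg_left (abs_sub_le_iff.2 ⟨?_, ?_⟩) (inv_pos.2 hn).le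
    · linarith [(hKb (φ n + 1) t ht x).2, hK0.1]
    · linarith [(hKb (φ n + 1) t ht x).1, hK0.2]
  have hd0 : Tendsto d atTop (𝓝 0) := by
    refine squeeze_zero_norm hdb ?_
    have h1 : Tendsto (fun n => (φ n : ℝ) + 1) atTop atTop :=
      tendsto_atTop_add_const_right _ 1 (tendsto_natCast_atTop_atTop.comp hφ.tendsto_atTop)
    simpa using (tendsto_inv_atTop_zero.comp h1).mul_const (C * ((0:ℝ) - t) ^ (-(3:ℝ) / 2))
  -- `g_c A_{φ n}(t,x) = A_{φ n}(t,x) + d n`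
  have hsplit : ∀ n, c ^ 3 * (((φ n : ℝ) + 1)⁻¹ * ∑ k ∈ Finset.range (φ n + 1),
      (c ^ k) ^ 3 * K ((c ^ k) ^ 2 * (c ^ 2 * t)) (rotZ (-(α * (2 * Real.log (c ^ k))))
        ((c ^ k) • rotZ (-(α * (2 * Real.log c))) (c • x)))) =
      ((φ n : ℝ) + 1)⁻¹ * ∑ k ∈ Finset.range (φ n + 1),
        (c ^ k) ^ 3 * K ((c ^ k) ^ 2 * t) (rotZ (-(α * (2 * Real.log (c ^ k)))) ((c ^ k) • x)) +
      d n := fun n => by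
    rw [hd]
    linarith [screw_average_sub α K hc (φ n) t x]
  have hA' : Tendsto (fun n => ((φ n : ℝ) + 1)⁻¹ * ∑ k ∈ Finset.range (φ n + 1),
        (c ^ k) ^ 3 * K ((c ^ k) ^ 2 * t) (rotZ (-(α * (2 * Real.log (c ^ k)))) ((c ^ k) • x)) +
      d n) atTop (𝓝 (c ^ 3 * G (c ^ 2 * t) (rotZ (-(α * (2 * Real.log c))) (c • x)))) :=
    hA.congr fun n => hsplit n
  have hB' := hB.add hd0
  rw [add_zero] at hB'
  exact tendsto_nhds_unique hA' hB'

/-- **Registered helper stub `stub_coRotatingKernel_screwAverage`** (one-line signature on the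
crux item; helper for `stub_coRotatingKernel`, file 2/3): the explicit-binder form of
`screw_invariant_of_tendsto_average`. -/
theorem stub_coRotatingKernel_screwAverage :
    ∀ (α c C : ℝ) (K G : ℝ → EuclideanSpace ℝ (Fin 3) → ℝ) (φ : ℕ → ℕ), 0 < c → StrictMono φ → (∀ (k : ℕ) (t : ℝ), t < 0 → ∀ x : EuclideanSpace ℝ (Fin 3), 0 ≤ (c ^ k) ^ 3 * K ((c ^ k) ^ 2 * t) (Literature.Analysis.FluidPDE.rotZ (-(α * (2 * Real.log (c ^ k)))) ((c ^ k) • x)) ∧ (c ^ k) ^ 3 * K ((c ^ k) ^ 2 * t) (Literature.Analysis.FluidPDE.rotZ (-(α * (2 * Real.log (c ^ k)))) ((c ^ k) • x)) ≤ C * ((0:ℝ) - t) ^ (-(3:ℝ) / 2)) → (∀ t : ℝ, t < 0 → ∀ x : EuclideanSpace ℝ (Fin 3), Filter.Tendsto (fun n => ((φ n : ℝ) + 1)⁻¹ * ∑ k ∈ Finset.range (φ n + 1), (c ^ k) ^ 3 * K ((c ^ k) ^ 2 * t) (Literature.Analysis.FluidPDE.rotZ (-(α * (2 * Real.log (c ^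 k)))) ((c ^ k) • x))) Filter.atTop (nhds (G t x))) → ∀ t : ℝ, t < 0 → ∀ x : EuclideanSpace ℝ (Fin 3), c ^ 3 * G (c ^ 2 * t) (Literature.Analysis.FluidPDE.rotZ (-(α * (2 * Real.log c))) (c • x)) = G t x :=
  fun _ _ _ _ _ _ hc hφ hKb hlim => screw_invariant_of_tendsto_average hc hφ hKb hlim

end Summit.NavierStokesRegularity.NavierStokesRegularity.Theorems.FrequencyRigidity.MovingAdjointBernoulli

end
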